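import Literature.NumberTheory.Rogawski1990.SingularArchSignatureData
import Literature.NumberTheory.Rogawski1990.SingularSemisimpleFrame
import HarnessLib

/-!
# Local realisation at infinity, part B: every archimedean class in the archimedean stable class of a split-semisimple rational element has
# a rational representative (Rogawski 1990, §3.3 Prop. 3.3.1 p. 22, §3.8 Prop. 3.8.1 (d) p. 30, §14.1 p. 232)

Topic `NumberTheory/Rogawski1990`; namespace `Literature.NumberTheory.Rogawski1990`; **THEOREMS ONLY** (no definition, no named fact, no instance, no
notation, no `sorry`).  Cell `pub/hodgecm-mathlib`, ENGINE T1 (crux H413 = `stmt-HodgeConjecture-24833`), row O7 «singular semisimple classes», piece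
**(LR-∞q) = (LR-∞)** (O7 OWNER WORD #22 placement; consumer: F0P3a-p06's ED 1.24 anchor leaf, binder `hLR∞`).  HC_CM is proved only modulo the printed
citations until rung 0 closes.

THE MATHEMATICS [Rogawski1990, §3.8 Prop. 3.8.1 (d); §14.1].  `H ∈ M₃(L)` hermitian non-degenerate over the CM field `L` (ANY signature — no anisotropy,
no definiteness), `γ₀ ∈ U(H)(L⁺)` split semisimple: `(γ₀ − α)(γ₀ − β) = 0`, `α ≠ β` (central `γ₀` allowed).  If `x ∈ U(H)(L ⊗ ℝ)` CORRESPONDS to `γ₀` at `∞` —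
`x` is conjugate to `γ₀ ⊗ 1` inside `GL₃(L ⊗ ℝ)` (★ `Corresponds` unfolded; the unfolded `IsConj` form is the one that typechecks for `x : ↥U(H)(L⊗ℝ)`) —
then some RATIONAL `δ ∈ U(H)(L⁺)`, stably conjugate to `γ₀`, has `δ ⊗ 1` conjugate to `x` INSIDE `U(H)(L ⊗ ℝ)`.  Proof: central `γ₀` is trivial (`x = γ₀ ⊗ 1`).
Otherwise frame `γ₀` (★ `exists_singular_frame`), take the archimedean data `(p, ξ)` of the conjugator (part A), realise them by a rational `⋆`-symmetric
unit `y ∈ Z(γ₀)` with `det y = 1` and `#pos ρ(H·y) = #pos ρ(H)` for every `ρ` (★ B-p12 (R6a-s′) `exists_commute_hermStar_eq_of_frame_of_signature_clause5`);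
Landherr's theorem and «`hγ₀h⁻¹ ∈ U(H)` when `H_h = H·y`, `y ∈ Z(γ₀)`» (★ R6a `exists_unitary_conj_inv_mul_twistGram_eq_of_invariants`) give `h ∈ GL₃(L)`,
`δ := hγ₀h⁻¹ ∈ U(H)(L⁺)` with `H_h = H·y`; at `∞` the forms `H_{g,∞}` and `(H·y) ⊗ 1 = H_{h⊗1,∞}` are framed by `P⊗1` with EQUAL block signatures (part A (iv) +
the construction of `y`), so ★ (h3′) `exists_commute_twistGram_arch_eq_of_block_signatures_cm` yields `t ∈ Z(γ₀⊗1)` with `ᵗ(σ_∞t) H_{g,∞} t = (H·y)⊗1`, and ★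
`exists_unitary_conj_of_twistGram_eq` turns `(g, t, h⊗1)` into `u ∈ U(H)(L⊗ℝ)` with `u (δ⊗1) u⁻¹ = x`.  NOTE: `δ` is in general NOT conjugate to `γ₀` at the
finite places where `ξ` is not a local norm (reciprocity moves the obstruction there) — (LR-∞) asks nothing there.

* §3 **`exists_isStablyConj_and_isConj_arch_of_isConj_arch`** `(hH hHd) {α β} (hαβ) (γ₀ : (cmDatum L 3 H).Rational) (hγ₀) (x : ↥(UnitaryGroup.arch L⁺ L c 3 H))
  (hx : IsConj ((cmRationalToArch L 3 H γ₀ : ↥arch) : GL₃(L⊗ℝ)) (x : GL₃(L⊗ℝ))) : ∃ δ, IsStablyConj (cmConjRingHom L) H γ₀ δ ∧ IsConj (cmRationalToArch L 3 H δ) x`.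

## References
* [Rogawski1990] J. D. Rogawski, *Automorphic Representations of Unitary Groups in Three Variables*, Ann. of Math. Stud. 123 (1990), §3.3 Prop. 3.3.1 p. 22,
  §3.8 Prop. 3.8.1 (d) p. 30, §14.1 p. 232 (the correspondence `γ′ ↔ γ`).
* [Landherr1936HermitianForms] W. Landherr, Abh. Math. Sem. Hamburg 11 (1936) 245–248.
* [Kottwitz1986] R. E. Kottwitz, *Stable trace formula: elliptic singular terms*, Math. Ann. 275 (1986), §7.
-/

set_option autoImplicit false

noncomputable section

open NumberField NumberField.InfinitePlace
open scoped Matrix MatrixGroups ComplexConjugate ComplexOrder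

namespace Literature.NumberTheory.Rogawski1990

open Literature.NumberTheory.Automorphic Literature.NumberTheory.Automorphic.UnitaryGroup
open Literature.AlgebraicGeometry.ShimuraVarieties (unitaryGroup mem_unitaryGroup_iff)

/-! ## §3 (LR-∞) Local realisation at infinity for a split-semisimple class -/

section ArchRealisation

variable {L : Type} [Field L] [NumberField L] [IsCMField L] {H : Matrix (Fin 3) (Fin 3) L}

/-- **(LR-∞) LOCAL REALISATION AT INFINITY FOR A SPLIT-SEMISIMPLE CLASS.**  `H ∈ M₃(L)` hermitian non-degenerate over the CM field `L` (ANY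
signature, no anisotropy), `γ₀ ∈ U(H)(L⁺)` with `(γ₀ − α)(γ₀ − β) = 0`, `α ≠ β` (central `γ₀` allowed).  If `x ∈ U(H)(L ⊗ ℝ)` is conjugate to `γ₀ ⊗ 1`
inside `GL₃(L ⊗ ℝ)` («`x` CORRESPONDS to `γ₀` at `∞`» — ★ `Corresponds` unfolded, which is the form that typechecks for `x : U(H)(L⊗ℝ)`), then there is a
RATIONAL `δ ∈ U(H)(L⁺)`, stably conjugate to `γ₀`, with `δ ⊗ 1` conjugate to `x` INSIDE `U(H)(L ⊗ ℝ)`: every archimedean conjugacy class in the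
archimedean stable class of `γ₀` has a rational representative.  Proof: central `γ₀` is trivial; otherwise frame `γ₀` (★ `exists_singular_frame`), take the
archimedean data `(p, ξ)` of the conjugator (§2 `exists_archSignatureData_of_conj_mem_arch`), realise them by a rational `⋆`-symmetric unit `y ∈ Z(γ₀)`,
`det y = 1`, `#pos ρ(H·y) = #pos ρ(H)` (★ B-p12 (R6a-s′) `exists_commute_hermStar_eq_of_frame_of_signature_clause5`), then Landherr + «`hγ₀h⁻¹ ∈ U(H)` iff
`H_h = H·y`, `y ∈ Z(γ₀)`» (★ R6a `exists_unitary_conj_inv_mul_twistGram_eq_of_invariants`) give `δ := h γ₀ h⁻¹ ∈ U(H)(L⁺)` with `H_h = H y`; ★ (h3′) `exists_commute_twistGram_arch_eq_of_block_signatures_cm`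
(block signatures equal by §2 (iv) and the construction of `y`) gives `t ∈ Z(γ₀ ⊗ 1)` with `ᵗ(σ_∞ t) H_{g,∞} t = (Hy) ⊗ 1 = H_{h⊗1,∞}`, and ★ `exists_unitary_conj_of_twistGram_eq` turns `(g, t, h ⊗ 1)` into
`u ∈ U(H)(L ⊗ ℝ)` with `u (δ ⊗ 1) u⁻¹ = x`.  (The rational `δ` need NOT be conjugate to `γ₀` at the finite places where `ξ` is not a local norm — reciprocity
puts the obstruction there; at `∞` there is none.) [cite: Rogawski1990, §3.8 Prop. 3.8.1 (d) p. 30; §3.3 Prop. 3.3.1 p. 22; §14.1 p. 232] [cite: Landherr1936HermitianForms] -/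
theorem exists_isStablyConj_and_isConj_arch_of_isConj_arch (hH : (H.map (cmConjRingHom L))ᵀ = H) (hHd : H.det ≠ 0) {α β : L} (hαβ : α ≠ β)
    (γ₀ : (UnitaryGroup.cmDatum L 3 H).Rational)
    (hγ₀ : ((((γ₀ : unitaryGroup (cmConjRingHom L) H).val : GL (Fin 3) L) : Matrix (Fin 3) (Fin 3) L) - α • 1) *
      ((((γ₀ : unitaryGroup (cmConjRingHom L) H).val : GL (Fin 3) L) : Matrix (Fin 3) (Fin 3) L) - β • 1) = 0)
    (x : ↥(UnitaryGroup.arch (↥(maximalRealSubfield L)) L (IsCMField.complexConj L) 3 H))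
    (hx : IsConj ((cmRationalToArch L 3 H γ₀ : ↥(UnitaryGroup.arch (↥(maximalRealSubfield L)) L (IsCMField.complexConj L) 3 H)) :
      GL (Fin 3) (mixedEmbedding.mixedSpace L)) (x : GL (Fin 3) (mixedEmbedding.mixedSpace L))) :
    ∃ δ : (UnitaryGroup.cmDatum L 3 H).Rational,
      IsStablyConj (cmConjRingHom L) H (γ₀ : unitaryGroup (cmConjRingHom L) H) (δ : unitaryGroup (cmConjRingHom L) H) ∧
        IsConj (cmRationalToArch L 3 H δ) x := by
  -- LETTERS at `∞`
  set σv := UnitaryGroup.conjMixed (↥(maximalRealSubfield L)) L (IsCMField.complexConj L) with hσv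
  set F : L →+* mixedEmbedding.mixedSpace L := NumberField.mixedEmbedding L with hFdef
  have hc1 : IsCMField.complexConj L ≠ 1 := IsCMField.complexConj_ne_one L
  have hfix : ∀ w : InfinitePlace L, IsCMField.complexConj L • w = w := UnitaryGroup.complexConj_smul_infinitePlace L
  have hF : ∀ r : L, F ((cmConjRingHom L) r) = σv (F r) := fun r => by
    rw [hFdef, hσv, UnitaryGroup.conjMixed_mixedEmbedding]; rfl
  have hFw : ∀ (w : {w : InfinitePlace L // w.IsComplex}) (r : L), UnitaryGroup.evalC L w (F r) = w.1.embedding r := fun w r => by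
    rw [hFdef, UnitaryGroup.evalC_apply, NumberField.mixedEmbedding.mixedEmbedding_apply_isComplex]
  have hFmw : ∀ (w : {w : InfinitePlace L // w.IsComplex}) {m k : ℕ} (M : Matrix (Fin m) (Fin k) L),
      (M.map F).map (UnitaryGroup.evalC L w) = M.map w.1.embedding := by
    intro w m k M; rw [Matrix.map_map]; exact Matrix.ext fun i j => hFw w (M i j)
  have harchF : archFormOf L 3 H = H.map F := by rw [hFdef]; rfl
  have hcoe : ∀ δ : (UnitaryGroup.cmDatum L 3 H).Rational,
      ((cmRationalToArch L 3 H δ : ↥(UnitaryGroup.arch (↥(maximalRealSubfield L)) L (IsCMField.complexConj L) 3 H)) :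
        GL (Fin 3) (mixedEmbedding.mixedSpace L)) =
        Matrix.GeneralLinearGroup.map F ((δ : unitaryGroup (cmConjRingHom L) H).val : GL (Fin 3) L) := fun δ => by
    rw [hFdef]; rfl
  clear_value F
  -- names
  set γu : unitaryGroup (cmConjRingHom L) H := (γ₀ : unitaryGroup (cmConjRingHom L) H) with hγu
  set γm : Matrix (Fin 3) (Fin 3) L := ((γu : GL (Fin 3) L) : Matrix (Fin 3) (Fin 3) L) with hγm
  set Hv : Matrix (Fin 3) (Fin 3) (mixedEmbedding.mixedSpace L) := H.map F with hHv
  have hHu : IsUnit H.det := isUnit_iff_ne_zero.mpr hHd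
  have hσF : (⇑σv ∘ ⇑F : L → mixedEmbedding.mixedSpace L) = ⇑F ∘ ⇑(cmConjRingHom L) := funext fun r => (hF r).symm
  -- the conjugator `g`
  rw [hcoe] at hx
  obtain ⟨g, hg⟩ := isConj_iff.mp hx
  -- CENTRAL `γ₀`: `x = γ₀ ⊗ 1`, `δ := γ₀`
  have hcentral : ∀ c : L, γm = c • (1 : Matrix (Fin 3) (Fin 3) L) →
      ∃ δ : (UnitaryGroup.cmDatum L 3 H).Rational,
        IsStablyConj (cmConjRingHom L) H (γ₀ : unitaryGroup (cmConjRingHom L) H) (δ : unitaryGroup (cmConjRingHom L) H) ∧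
          IsConj (cmRationalToArch L 3 H δ) x := by
    intro c hc
    refine ⟨γ₀, IsStablyConj.refl _, ?_⟩
    have hxe : (x : GL (Fin 3) (mixedEmbedding.mixedSpace L)) = Matrix.GeneralLinearGroup.map F (γu : GL (Fin 3) L) := by
      rw [← hg]
      refine Units.ext ?_
      change (g : Matrix (Fin 3) (Fin 3) (mixedEmbedding.mixedSpace L)) * γm.map F * ((g⁻¹ : GL (Fin 3) (mixedEmbedding.mixedSpace L)) :
        Matrix (Fin 3) (Fin 3) (mixedEmbedding.mixedSpace L)) = γm.map F
      rw [hc, Matrix.map_smul' _ _ _ (map_mul F), Matrix.map_one _ (map_zero F) (map_one F), Matrix.mul_smul, Matrix.mul_one, Matrix.smul_mul,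
        Units.mul_inv]
    have hxeq : x = cmRationalToArch L 3 H γ₀ := Subtype.ext (by rw [hcoe]; exact hxe)
    rw [hxeq]
  by_cases hα : γm = α • 1
  · exact hcentral α hα
  by_cases hβ : γm = β • 1
  · exact hcentral β hβ
  -- NON-CENTRAL: the plane-first frame (★ `exists_singular_frame`)
  obtain ⟨a, b, P, Ha, Hb, hord, -, -, hP, hγP, hHa, hHb, hda, hdb⟩ :=
    exists_singular_frame (σ := cmConjRingHom L) (IsCMField.complexConj_apply_apply (K := L)) H hH hHd γu hαβ hγ₀ hα hβ
  have hab : a ≠ b := by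
    rcases hord with ⟨rfl, rfl⟩ | ⟨rfl, rfl⟩
    · exact hαβ
    · exact hαβ.symm
  -- the archimedean data of `g` (§2)
  have hgmem : g * Matrix.GeneralLinearGroup.map F (γu : GL (Fin 3) L) * g⁻¹ ∈
      UnitaryGroup.arch (↥(maximalRealSubfield L)) L (IsCMField.complexConj L) 3 H := by
    rw [hg]; exact x.2
  obtain ⟨p, ξ, hξσ, hξ0, hp, hsign, htot, y₁, y₂, hG'P, hpl, hli⟩ :=
    exists_archSignatureData_of_conj_mem_arch hH hHd hab γu hP hγP hHa hHb hda hdb g (by rw [hFdef] at hgmem; exact hgmem)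
  rw [← hFdef] at hG'P hpl hli
  -- the rational `y` (★ (R6a-s′), clause-5 letters)
  obtain ⟨y, Ya, Yb, -, hcomm, hstar, hdet1, -, -, -, -, hyP, hYbξ, hpYa, hsigy⟩ :=
    exists_commute_hermStar_eq_of_frame_of_signature_clause5 hH hHd γm hP hγP hHa hHb hda hdb hξσ hξ0 p hp hsign htot
  -- Landherr + unitarity of `h γ₀ h⁻¹` (★ R6a)
  have hy0 : y.det ≠ 0 := by rw [hdet1]; exact one_ne_zero
  obtain ⟨h, δ, hhδ, hst, hcl⟩ := exists_unitary_conj_inv_mul_twistGram_eq_of_invariants L hH hHd γu hcomm hstar hy0 hsigy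
    ⟨1, one_ne_zero, by rw [hdet1, map_one, mul_one]⟩
  refine ⟨δ, hst, ?_⟩
  -- at `∞`: the form `(H y) ⊗ 1`, framed `Y_a ⊗ 1 ⊕ᶠ Y_b ⊗ 1`
  have hHy : ((H * y).map (cmConjRingHom L))ᵀ = H * y := (conjTranspose_mul_eq_self_iff (cmConjRingHom L) H hH hHu y).mpr hstar
  have hG'' : (((H * y).map F).map σv)ᵀ = (H * y).map F := by
    rw [Matrix.map_map, hσF, ← Matrix.map_map, ← Matrix.transpose_map, hHy]
  have hG''d : IsUnit ((H * y).map F).det := by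
    rw [← RingHom.mapMatrix_apply, ← RingHom.map_det, Matrix.det_mul, hdet1, mul_one]; exact hHu.map F
  have hG''P : twistGram σv ((H * y).map F) ((P : Matrix (Fin 3) (Fin 3) L).map F) = finSum 2 1 (Ya.map F) (Yb.map F) := by
    rw [← twistGram_map (cmConjRingHom L) (H * y) σv F hF, twistGram_def, hyP, finSum_map]
  have hX₁ : ∀ (w : {w : InfinitePlace L // w.IsComplex}) (h₁ : ((Ya.map F).map (UnitaryGroup.evalC L w)).IsHermitian),
      (Finset.univ.filter fun i => 0 < h₁.eigenvalues i).card = p w.1 := by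
    intro w h₁
    have h₂ : (Ya.map w.1.embedding).IsHermitian := by rw [← hFmw w Ya]; exact h₁
    have e : (Finset.univ.filter fun i => 0 < h₁.eigenvalues i).card = (Finset.univ.filter fun i => 0 < h₂.eigenvalues i).card := by
      have hm := hFmw w Ya
      revert h₁ h₂
      rw [hm]
      intro h₁ h₂
      rfl
    rw [e, hpYa w.1.embedding h₂, InfinitePlace.mk_embedding]
  have hX₂ : ∀ (w : {w : InfinitePlace L // w.IsComplex}) (h₁ : ((Yb.map F).map (UnitaryGroup.evalC L w)).IsHermitian),
      (Finset.univ.filter fun i => 0 < h₁.eigenvalues i).card = if 0 < (w.1.embedding (ξ⁻¹ * Hb 0 0)).re then 1 else 0 := by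
    intro w h₁
    rw [card_pos_eigenvalues_fin_one h₁, Matrix.map_apply, Matrix.map_apply, hFw, hYbξ, Matrix.smul_apply, smul_eq_mul]
  -- ★ (h3′) at `∞`: `H_{g,∞}` versus `(H y) ⊗ 1`, equal block signatures
  have hHvd : IsUnit Hv.det := by rw [hHv, ← RingHom.mapMatrix_apply, ← RingHom.map_det]; exact hHu.map F
  have hσσv : ∀ z, σv (σv z) = z := conjMixed_conjMixed_apply _ L _ hc1 hfix
  have hσvHv : (Hv.map σv)ᵀ = Hv := by rw [hHv, Matrix.map_map, hσF, ← Matrix.map_map, ← Matrix.transpose_map, hH]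
  have hG' : ((twistGram σv Hv (g : Matrix (Fin 3) (Fin 3) (mixedEmbedding.mixedSpace L))).map σv)ᵀ =
      twistGram σv Hv (g : Matrix (Fin 3) (Fin 3) (mixedEmbedding.mixedSpace L)) := conjTranspose_twistGram σv Hv hσσv hσvHv _
  have hgd : IsUnit (g : Matrix (Fin 3) (Fin 3) (mixedEmbedding.mixedSpace L)).det := Matrix.isUnits_det_units g
  have hG'd : IsUnit (twistGram σv Hv (g : Matrix (Fin 3) (Fin 3) (mixedEmbedding.mixedSpace L))).det := by
    rw [det_twistGram]; exact ((hgd.map σv).mul hHvd).mul hgd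
  have hsmul1 : ∀ (n : ℕ) (c : L), (c • (1 : Matrix (Fin n) (Fin n) L)).map F = F c • (1 : Matrix (Fin n) (Fin n) (mixedEmbedding.mixedSpace L)) :=
    fun n c => by rw [Matrix.map_smul' _ _ _ (map_mul F), Matrix.map_one _ (map_zero F) (map_one F)]
  have hγv_frame : γm.map F * (P : Matrix (Fin 3) (Fin 3) L).map F = (P : Matrix (Fin 3) (Fin 3) L).map F *
      finSum 2 1 (F a • (1 : Matrix (Fin 2) (Fin 2) (mixedEmbedding.mixedSpace L))) (F b • (1 : Matrix (Fin 1) (Fin 1) (mixedEmbedding.mixedSpace L))) := by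
    rw [hγm, ← Matrix.map_mul, hγP, Matrix.map_mul, finSum_map, hsmul1, hsmul1]
  have hPv : ((Matrix.GeneralLinearGroup.map F P : GL (Fin 3) (mixedEmbedding.mixedSpace L)) : Matrix (Fin 3) (Fin 3) (mixedEmbedding.mixedSpace L)) =
      (P : Matrix (Fin 3) (Fin 3) L).map F := rfl
  rw [← hPv] at hγv_frame hG'P hG''P
  obtain ⟨t, htγ, htG⟩ := exists_commute_twistGram_arch_eq_of_block_signatures_cm L hG' hG'' hG'd hG''d
    hγv_frame hG'P hG''P (fun w h₁ h₂ => by rw [hpl w h₁, hX₁ w h₂]) (fun w h₁ h₂ => by rw [hli w h₁, hX₂ w h₂])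
  -- ★ `exists_unitary_conj_of_twistGram_eq` over `L ⊗ ℝ`
  have hδ' : Matrix.GeneralLinearGroup.map F h * Matrix.GeneralLinearGroup.map F (γu : GL (Fin 3) L) * (Matrix.GeneralLinearGroup.map F h)⁻¹ =
      Matrix.GeneralLinearGroup.map F ((δ : unitaryGroup (cmConjRingHom L) H).val : GL (Fin 3) L) := by
    rw [← map_inv, ← map_mul, ← map_mul, hhδ]
  have hTh : twistGram (cmConjRingHom L) H (h : Matrix (Fin 3) (Fin 3) L) = H * y := by
    rw [← hcl, ← Matrix.mul_assoc, Matrix.mul_nonsing_inv _ hHu, Matrix.one_mul]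
  have hheq : twistGram σv Hv ((Matrix.GeneralLinearGroup.map F h : GL (Fin 3) (mixedEmbedding.mixedSpace L)) : Matrix (Fin 3) (Fin 3) _) =
      twistGram σv Hv ((g * t : GL (Fin 3) (mixedEmbedding.mixedSpace L)) : Matrix (Fin 3) (Fin 3) (mixedEmbedding.mixedSpace L)) := by
    change twistGram σv Hv ((h : Matrix (Fin 3) (Fin 3) L).map F) = _
    rw [hHv, ← twistGram_map (cmConjRingHom L) H σv F hF, hTh, Units.val_mul, twistGram_mul, ← twistGram_def, htG]
  obtain ⟨u, hu, huc⟩ := exists_unitary_conj_of_twistGram_eq σv Hv hg hδ' (Units.ext htγ) hheq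
  have huarch : u ∈ UnitaryGroup.arch (↥(maximalRealSubfield L)) L (IsCMField.complexConj L) 3 H := by
    rw [UnitaryGroup.mem_arch_iff, harchF]
    exact mem_unitaryGroup_iff.mp hu
  refine isConj_iff.mpr ⟨⟨u, huarch⟩, Subtype.ext ?_⟩
  change u * ((cmRationalToArch L 3 H δ : ↥(UnitaryGroup.arch (↥(maximalRealSubfield L)) L (IsCMField.complexConj L) 3 H)) :
    GL (Fin 3) (mixedEmbedding.mixedSpace L)) * u⁻¹ = (x : GL (Fin 3) (mixedEmbedding.mixedSpace L))
  rw [hcoe]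
  exact huc

end ArchRealisation


end Literature.NumberTheory.Rogawski1990

end
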